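import Literature.AnabelianGeometry.EtaleTheta.Discharge.Sec1Thm110ModelChiInversionNV
import Literature.AnabelianGeometry.EtaleTheta.SettingModelChiThetaDoubleUnderline
import HarnessLib

/-!
# The χ-twisted root model of [EtTh] §1: the INVERSION versus the DEF. 1.9 SECTIONS at `modelχ` — `ε_±` carries `D_τ` to
# a `Π^tp_X̲̲ ∩ Δ^tp_Ÿ`-conjugate of `D_{τ⁻¹}` AND `D_{τ⁻¹}` to the SAME conjugate of `D_τ` (every unit `u`; PROOF-ONLY)

S. Mochizuki, *The étale theta function and its Frobenioid-theoretic manifestations*, Publ. RIMS **45** (2009) [EtTh],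
§1, Def. 1.9 p. 29 (the `K̈`-points `τ`, `τ⁻¹` of `Ÿ`, `Ü = √−1^{±1}`), Rmk. 1.9.1 p. 29 («`ε_μ`, `ε_±` map
`η̈^{Θ,Z} ↦ −η̈^{Θ,Z}`»), §2 p. 36 («`ι` … "multiplication by `−1`"»), Def. 2.7 p. 41 / Cor. 2.8 (i) p. 42 (orbits
restricted to `D_τ ∩ Π^tp_X̲̲`, `D_{τ⁻¹} ∩ Π^tp_X̲̲`) [cite: MochizukiEtTh2009, Def 1.9 p.29]; Prop. 1.4 (iii) p. 22.
Kummer theory: J. Neukirch, *Algebraic Number Theory*, Ch. IV §3 [cite: NeukirchANT1999, Ch. IV §3].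

abc-iut cell, layer L2, seat abc-iut-w5-d118 (gen 6); abc-iut-L2-lead row R413 «R374-b PREREQ — INVERSION vs THE DEF 1.9
SECTIONS AT modelχ» (prerequisite of the parked row R374/R383 «hDtau′ INNER-ADJUSTED WITNESS AT modelχ»: the binder
«`∃ u ∈ Π^tp_X̲̲, ∀ Dt ∈ {D_τ, D_{τ⁻¹}}, Dt.map (Γ ≫ γ_u) ∈ {D_τ, D_{τ⁻¹}}`» of this seat's
`EtaleThetaDataOfSettingRootHypOfCor28iInner` / `prop34i_multiradiallyDefined_saturated_ofCor28i_innerAdjust`,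
FINDING F-w5d118g5-1). PROOF-ONLY (no `def`, no instance, no `Prop` fact).

PRIOR ART, consumed BY NAME (nothing restated): abc-iut-w5-d140's `Discharge/Sec1Thm110ModelChiInversionNV` /
`…ModelChiDeck` already prove, for `τ = √−1` and `p ≡ 1 (4)`, `exists_invχ_sectionOfUnitχ_conj : ι(s_τ σ) =
inl(b^{c₀²})·s_{τ⁻¹}(σ)·inl(b^{c₀²})⁻¹` (conjugator recorded in `Π^tp_Ẍ`; Thm. 1.10 (ii) second alternative),
`exists_coboundary_kappa_mul_kappaInv` and the component lemmas `inl_bPowGfp_conj_sectionχ_left/right`; abc-iut-L2-t6's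
`sectionχ` / `sectionOfUnitχ u = sectionχ (κ_u·κ_u)` (`·` = the group law of `Ẑ`, ADDITIVELY `2κ_u`) / `kappaUnitχ` /
`anchoredPointχ`; abc-iut-w5-d072's `twistedInversion (chi p)` = `ε_±`-conjugation on `Π^tp_X` at abc-iut-w5-d140's
`MuTwoSetting.inversionModelχ` (`epsPM_conj_inlχ`); `tauχ` / `tauInvχ`; abc-iut-L2-t5's `kummerZH_eq_mul_coboundary`,
`chiCocycle_*`; abc-iut-L2-t10's `gfpInv_bPowGfp_eq`; abc-iut-L2-d1's `Huuχ`. CONTRAST with abc-iut-w5-d125's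
`ThetaKummerInversionFixedPoints` (`twistedInversion_fix_inr`): `ι` FIXES the CUSPIDAL section `inr(G_{ℚ_p})` (`Ü = 1`)
pointwise; the Def. 1.9 sections are the `b`-axis sections TWISTED by `2κ_u`, and there:

WHAT IS ADDED HERE (the currency the `Dtau` binder needs: ONE `g ∈ Π^tp_X̲̲`, BOTH members of the pair, every `u`):
* (A) `twistedInversion_sectionχ` — `ι ⟨b^{f σ}, σ⟩ = ⟨b^{(f σ)⁻¹}, σ⟩` for EVERY `χ`-cocycle `f` (so the defect of
  `ι`-invariance of `s_u` is twice the Kummer cocycle of `u` — §1-section twin of w5-d125's `kummerCocycle_mul_inversionRoot_eq`);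
  (B) `conj_inl_bPowGfp_sectionχ` — `inl(b^t)·⟨b^{f σ}, σ⟩·inl(b^t)⁻¹` IS the section twisted by `f · (χ-coboundary of t)`
  (`chiCocycle_coboundary`; components = w5-d140's lemmas); (C) `exists_kappaUnitχ_inv_eq` — for EVERY unit `u`:
  `κ_{u⁻¹} = κ_u⁻¹ · (χ(σ)z/z)` (`kummerZH_invRoots`, `unitχ_inv`);
* (D) MAIN `exists_conj_twistedInversion_sectionOfUnitχ` — for EVERY unit `u ∈ K̈^×` (any `p`) ONE explicit
  `g = inl(b^{w·w})` with `∀ l, g ∈ Huuχ p l` (`Π^tp_X̲̲`), `g ∈ Π^tp_Ÿ`, `g ∈ Π^tp_Ẍ`, `aug g = 1`, and for all `σ`: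
  `s_{u⁻¹}(σ) = g·ι(s_u σ)·g⁻¹` AND `s_u(σ) = g·ι(s_{u⁻¹} σ)·g⁻¹` (SAME conjugator both ways, as `ι g = g⁻¹`); subgroup form
  `map_conj_map_twistedInversion_sectionOfUnitχ` (`γ_g(ι D_u) = D_{u⁻¹}`, `γ_g(ι D_{u⁻¹}) = D_u`), anchored-point form
  `map_conj_map_twistedInversion_Dpt_anchoredPointχ`, and `map_sectionOfUnitχ_le_Huuχ` (`D_u ≤ Π^tp_X̲̲` for every `l`:
  «`D_τ ∩ Π^tp_X̲̲ = D_τ`» at the model);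
* (E) the `Π^tp_C` form at `MuTwoSetting.inversionModelχ`: conjugation by `inclX g · ε_±` SWAPS `inclX(D_u)` and
  `inclX(D_{u⁻¹})` (`exists_conj_inclX_mul_epsPM_sectionOfUnitχ`, `exists_map_conj_inclX_mul_epsPM_sectionOfUnitχ`) —
  the binder shape above with `Γ := conj ε_±`, decided POSITIVELY at the model;
* (F) `p ≡ 1 (4)`: `sqrtNegOneInvUnitχ_eq_inv`; w5-d140's r5 lemma UPGRADED (`exists_invχ_sectionOfUnitχ_conj_symm`: its
  conjugator lies in `Π^tp_X̲̲ ∩ Π^tp_Ÿ` and serves BOTH directions); the `τ`-instances `exists_conj_twistedInversion_tauχ`,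
  `exists_conj_inclX_mul_epsPM_tauχ`;
* (G) `exists_conj_innerTwistedInversion_sectionOfUnitχ` — the same for every `b`-twisted lift `Ad(inl b^m) ∘ ι`
  (conjugator `g·inl(b^m)⁻¹ ∈ Π^tp_X̲̲`; in `Π^tp_Ÿ` only for even `m`).

So at the model the pair `{D_τ, D_{τ⁻¹}}` is `ε_±`-stable UP TO ONE inner `γ_g`, `g ∈ Π^tp_X̲̲ ∩ Δ^tp_Ÿ` an explicit even
`b`-power (not on the nose in general: the `b`-power is a root-choice coboundary). HONEST FRAMING: SEMI-SYNTHETIC model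
(the χ-twisted root; not the tempered `π₁` of a curve) — consistency / non-vacuity evidence for OUR typed interface ONLY;
nothing of [EtTh] is asserted; typed ≠ proved; no side is taken on [IUTchIII] Cor. 3.12.
-/

noncomputable section

namespace Literature.AnabelianGeometry.EtaleTheta.SettingModel

open Literature.AnabelianGeometry.SemiGraphs _root_.Topology _root_.Function
open Literature.AnabelianGeometry.AbsoluteAnabelian (ZHatCompletion.exists_continuousMulEquiv_padicProd)

variable (p : ℕ) [Fact p.Prime]

/-! ### §0. Commutative bookkeeping in `Ẑ` (transport through `Ẑ ≃ ∏_p ℤ_p`) -/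

/-- `t·F·C⁻¹ = F·(t/C)` in `Ẑ`. [cite: RibesZalesskii2010, Thm 2.7.1] -/
private theorem zh_identity₁ (t F C : ZH) : t * F * C⁻¹ = F * (t / C) := by
  obtain ⟨e, -⟩ := ZHatCompletion.exists_continuousMulEquiv_padicProd
  apply e.injective
  simp only [map_mul, map_inv, map_div]
  apply Multiplicative.toAdd.injective
  simp only [toAdd_mul, toAdd_inv, toAdd_div]
  abel

/-- `(K⁻¹·(C/Z))·(K⁻¹·(C/Z)) = (K·K)⁻¹·((Z⁻¹·Z⁻¹)/(C⁻¹·C⁻¹))` in `Ẑ`. [cite: RibesZalesskii2010, Thm 2.7.1] -/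
private theorem zh_identity₂ (K C Z : ZH) :
    K⁻¹ * (C / Z) * (K⁻¹ * (C / Z)) = (K * K)⁻¹ * (Z⁻¹ * Z⁻¹ / (C⁻¹ * C⁻¹)) := by
  obtain ⟨e, -⟩ := ZHatCompletion.exists_continuousMulEquiv_padicProd
  apply e.injective
  simp only [map_mul, map_inv, map_div]
  apply Multiplicative.toAdd.injective
  simp only [toAdd_mul, toAdd_inv, toAdd_div]
  abel

/-! ### §1. (A) The inversion INVERTS the `b`-axis twist of a section; (B) inner `b`-powers act by `χ`-coboundaries -/

variable (f : GQp p → ZH) (hf : ∀ σ τ : GQp p, f (σ * τ) = f σ * chi p σ (f τ))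

/-- Two `b`-axis sections with the same twist value at `σ` agree at `σ` (the section only sees `f σ`).
[cite: MochizukiEtTh2009, Prop 1.4 (iii) p.22] -/
theorem sectionχ_congr {f f' : GQp p → ZH} (hf : ∀ σ τ : GQp p, f (σ * τ) = f σ * chi p σ (f τ))
    (hf' : ∀ σ τ : GQp p, f' (σ * τ) = f' σ * chi p σ (f' τ)) {σ : GQp p} (h : f σ = f' σ) :
    sectionχ p f hf σ = sectionχ p f' hf' σ :=
  SemidirectProduct.ext (by rw [sectionχ_left, sectionχ_left, h]) rfl

/-- **(A) `ι ⟨b^{f σ}, σ⟩ = ⟨b^{(f σ)⁻¹}, σ⟩`**: the twisted inversion `(γ, σ) ↦ (ι_Γ γ, σ)` INVERTS the twist of every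
`b`-axis section (`ι_Γ b^t = b^{t⁻¹}`). Contrast: it FIXES the untwisted cuspidal section `inr` (abc-iut-w5-d125's
`twistedInversion_fix_inr`). [cite: MochizukiEtTh2009, §2 p.36] -/
theorem twistedInversion_sectionχ (σ : GQp p) :
    twistedInversion (chi p) (sectionχ p f hf σ) = sectionχ p (fun σ => (f σ)⁻¹) (chiCocycle_inv hf) σ :=
  SemidirectProduct.ext (by rw [twistedInversion_left, sectionχ_left, sectionχ_left, gfpInv_bPowGfp_eq]) rfl

/-- The `χ`-COBOUNDARY `σ ↦ t / χ(σ)t` of `t ∈ Ẑ` is a `χ`-cocycle. [cite: NeukirchANT1999, Ch. IV §3] -/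
theorem chiCocycle_coboundary (t : ZH) (σ τ : GQp p) :
    t / chi p (σ * τ) t = t / chi p σ t * chi p σ (t / chi p τ t) := by
  rw [map_mul, MulAut.mul_apply, map_div]
  simp only [div_eq_mul_inv, mul_assoc, inv_mul_cancel_left]

/-- **(B) `inl(b^t) · ⟨b^{f σ}, σ⟩ · inl(b^t)⁻¹ = ⟨b^{f σ · t/χ(σ)t}, σ⟩`**: conjugation by the `b`-power `inl(b^t) ∈ Δ^tp_X`
changes the twist of a section by the `χ`-coboundary of `t` (`σ · b^t = b^{χ(σ) t}`). [cite: MochizukiEtTh2009, Prop 1.4 (iii) p.22] -/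
theorem conj_inl_bPowGfp_sectionχ (t : ZH) (σ : GQp p) :
    SemidirectProduct.inl (bPowGfp t) * sectionχ p f hf σ * (SemidirectProduct.inl (bPowGfp t))⁻¹ =
      sectionχ p (fun σ => f σ * (t / chi p σ t))
        (chiCocycle_mul (m := fun σ => t / chi p σ t) hf (chiCocycle_coboundary p t)) σ :=
  SemidirectProduct.ext
    (by rw [inl_bPowGfp_conj_sectionχ_left, sectionχ_left, zh_identity₁])
    (by rw [inl_bPowGfp_conj_sectionχ_right, sectionχ_right])

/-- (A) at the Def. 1.9 sections: `ι (s_u σ) = ⟨b^{(κ_u σ · κ_u σ)⁻¹}, σ⟩`. [cite: MochizukiEtTh2009, Def 1.9 p.29] -/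
theorem twistedInversion_sectionOfUnitχ (u : (↥(ThetaSetting.modelχ p).Kdd)ˣ) (σ : GQp p) :
    twistedInversion (chi p) (sectionOfUnitχ p u σ) =
      sectionχ p (fun σ => (kappaUnitχ p u σ * kappaUnitχ p u σ)⁻¹) (chiCocycle_inv (kappaUnitχ_sq_mul p u)) σ := by
  rw [sectionOfUnitχ_def, twistedInversion_sectionχ]
  rfl

/-! ### §2. (C) The Kummer cocycle of `u⁻¹` versus that of `u` -/

section Kummer

variable {p}
variable {v : (PadicAlgCl p)ˣ} (x : RootSystem v)
  (hv : v ∈ MulAction.fixedPoints (⊤ : Subgroup (GQp p)) (PadicAlgCl p)ˣ)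
  (hv' : v⁻¹ ∈ MulAction.fixedPoints (⊤ : Subgroup (GQp p)) (PadicAlgCl p)ˣ)

/-- **The cocycle of the INVERSE root system `(v^{1/N})⁻¹` of `v⁻¹` is the inverse cocycle.**
[cite: NeukirchANT1999, Ch. IV §3] -/
theorem kummerZH_invRoots (σ : GQp p) : kummerZH x.inv hv' σ = (kummerZH x hv σ)⁻¹ := by
  rw [kummerZH_def, kummerZH_def, ← map_inv]
  congr 1
  refine Subtype.ext (funext fun n => ?_)
  change σ • (x.root n)⁻¹ / (x.root n)⁻¹ = (σ • x.root n / x.root n)⁻¹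
  rw [smul_inv', inv_div_inv, inv_div]

end Kummer

/-- `K̈^× → ℚ̄_p^×` is a homomorphism: the unit `u⁻¹` read in `ℚ̄_p^×` is the inverse of `u` read there.
[cite: MochizukiEtTh2009, Prop 1.5 p.23] -/
theorem unitχ_inv (u : (↥(ThetaSetting.modelχ p).Kdd)ˣ) : unitχ p u⁻¹ = (unitχ p u)⁻¹ := by
  change (((kummerCoreχ p).toInvYdd u⁻¹ : (kummerCoreχ p).invYdd) : (PadicAlgCl p)ˣ) =
    ((((kummerCoreχ p).toInvYdd u : (kummerCoreχ p).invYdd) : (PadicAlgCl p)ˣ))⁻¹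
  rw [map_inv]
  rfl

/-- `(unitχ u)⁻¹` is `G_{ℚ_p}`-fixed. [cite: MochizukiEtTh2009, §1 p.17] -/
theorem unitχ_inv_mem_fixedPoints (u : (↥(ThetaSetting.modelχ p).Kdd)ˣ) :
    (unitχ p u)⁻¹ ∈ MulAction.fixedPoints (⊤ : Subgroup (GQp p)) (PadicAlgCl p)ˣ := by
  rw [← unitχ_inv]
  exact unitχ_mem_fixedPoints p u⁻¹

/-- **(C) `κ_{u⁻¹} = κ_u⁻¹ · (χ-coboundary)`**: the Kummer cocycle of `u⁻¹` for ITS chosen roots (`ofRootableBy (u⁻¹)`) is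
the inverse of that of `u` times the coboundary `σ ↦ χ(σ)z/z` of the explicit `z := e(x⁻¹/x') ∈ Ẑ` comparing the inverse
roots `x⁻¹` of `u` with the chosen roots `x'` of `u⁻¹` (a compatible system of roots of unity).
[cite: NeukirchANT1999, Ch. IV §3] -/
theorem exists_kappaUnitχ_inv_eq (u : (↥(ThetaSetting.modelχ p).Kdd)ˣ) :
    ∃ z : ZH, ∀ σ : GQp p, kappaUnitχ p u⁻¹ σ = (kappaUnitχ p u σ)⁻¹ * (chi p σ z / z) := by
  refine ⟨cycEquiv p (RootSystem.divCyclotome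
      ((RootSystem.ofRootableBy (unitχ p u)).inv.cast (unitχ_inv p u).symm) (RootSystem.ofRootableBy (unitχ p u⁻¹))),
    fun σ => ?_⟩
  rw [kappaUnitχ_def, kummerZH_eq_mul_coboundary ((RootSystem.ofRootableBy (unitχ p u)).inv.cast (unitχ_inv p u).symm)
      (unitχ_mem_fixedPoints p u⁻¹) (RootSystem.ofRootableBy (unitχ p u⁻¹)) σ,
    kummerZH_cast _ (unitχ_inv_mem_fixedPoints p u) (unitχ_inv p u).symm (unitχ_mem_fixedPoints p u⁻¹) σ,
    kummerZH_invRoots _ (unitχ_mem_fixedPoints p u) (unitχ_inv_mem_fixedPoints p u) σ, ← kappaUnitχ_def]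

/-! ### §3. (D) MAIN: `ι(D_u)` is an explicit `Π^tp_X̲̲ ∩ Δ^tp_Ÿ`-conjugate of `D_{u⁻¹}` — same conjugator both ways -/

/-- `inl(b^{w·w}) ∈ Π^tp_X̲̲` for every `l` (the `b`-axis has levels `(0, *, 0)`). [cite: MochizukiEtTh2009, Def 2.5 (i) p.39] -/
theorem inl_bPowGfp_mem_Huuχ (l : ℕ+) (t : ZH) : (SemidirectProduct.inl (bPowGfp t) : PiTpχ p) ∈ Huuχ p l := by
  rw [inl_mem_Huuχ_iff, mem_dUU_iff, levelHom_bPowGfp]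
  exact ⟨rfl, rfl⟩

/-- `inl(b^{w·w}) ∈ Π^tp_Ÿ` (an EVEN `b`-power: level-`2` `y`-coordinate `0`; `Π^tp_Ÿ = Π^tp_{Y₂}` at the χ-model).
[cite: MochizukiEtTh2009, §1 p.17] -/
theorem inl_bPowGfp_mul_self_mem_GtpYdd (w : ZH) :
    (SemidirectProduct.inl (bPowGfp (w * w)) : PiTpχ p) ∈ (ThetaSetting.modelχ p).GtpYdd := by
  rw [GtpYdd_modelχ, mem_YNχ_two_iff, SemidirectProduct.left_inl, bPowGfp_mem_dY_iff, map_mul]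
  generalize ZHatLevel.level 2 w = c
  rw [← ofAdd_toAdd c, ← ofAdd_add, ← two_nsmul]
  change Multiplicative.ofAdd ((2 : ℕ) • Multiplicative.toAdd c) = 1
  rw [nsmul_eq_mul]
  have h2 : ((2 : ℕ) : ZMod (2 : ℕ+)) = 0 := by decide
  rw [h2, zero_mul, ofAdd_zero]

/-- **(D) MAIN.** For every unit `u ∈ K̈^×` of the χ-model there is ONE explicit `g = inl(b^{w·w}) ∈ Π^tp_X` — in `Π^tp_X̲̲`
for every `l`, in `Π^tp_Ÿ`, in `Π^tp_Ẍ`, over `1 ∈ G_K` — such that for all `σ ∈ G_{ℚ_p} = G_K̈`: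
`s_{u⁻¹}(σ) = g · ι(s_u(σ)) · g⁻¹` AND `s_u(σ) = g · ι(s_{u⁻¹}(σ)) · g⁻¹` (`s_u := sectionOfUnitχ u`, `ι` the twisted
inversion = `ε_±`-conjugation). So `ι(D_u) = g⁻¹ D_{u⁻¹} g` and `ι(D_{u⁻¹}) = g⁻¹ D_u g` with the SAME `g` (`ι g = g⁻¹`).
Proof: (A) + (C) + (B) with `t := (z·z)⁻¹`. [cite: MochizukiEtTh2009, Def 1.9 p.29] -/
theorem exists_conj_twistedInversion_sectionOfUnitχ (u : (↥(ThetaSetting.modelχ p).Kdd)ˣ) :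
    ∃ g : PiTpχ p, (∃ w : ZH, g = SemidirectProduct.inl (bPowGfp (w * w))) ∧ (∀ l : ℕ+, g ∈ Huuχ p l) ∧
      g ∈ (ThetaSetting.modelχ p).GtpYdd ∧ g ∈ Xddχ p ∧ (ThetaSetting.modelχ p).aug g = 1 ∧
      ∀ σ : GQp p,
        sectionOfUnitχ p u⁻¹ σ = g * twistedInversion (chi p) (sectionOfUnitχ p u σ) * g⁻¹ ∧
        sectionOfUnitχ p u σ = g * twistedInversion (chi p) (sectionOfUnitχ p u⁻¹ σ) * g⁻¹ := by
  obtain ⟨z, hz⟩ := exists_kappaUnitχ_inv_eq p u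
  refine ⟨SemidirectProduct.inl (bPowGfp (z⁻¹ * z⁻¹)), ⟨z⁻¹, rfl⟩, fun l => inl_bPowGfp_mem_Huuχ p l _,
    inl_bPowGfp_mul_self_mem_GtpYdd p z⁻¹, inl_bPowGfp_mul_self_mem_Xddχ p z⁻¹, rfl, fun σ => ?_⟩
  have h1 : sectionOfUnitχ p u⁻¹ σ = SemidirectProduct.inl (bPowGfp (z⁻¹ * z⁻¹)) *
      twistedInversion (chi p) (sectionOfUnitχ p u σ) * (SemidirectProduct.inl (bPowGfp (z⁻¹ * z⁻¹)))⁻¹ := by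
    rw [twistedInversion_sectionOfUnitχ, conj_inl_bPowGfp_sectionχ, sectionOfUnitχ_def]
    refine sectionχ_congr p _ _ ?_
    rw [Pi.mul_apply, hz σ, map_mul, map_inv]
    exact zh_identity₂ _ _ _
  refine ⟨h1, ?_⟩
  have h2 := congrArg (twistedInversion (chi p)) h1
  rw [map_mul, map_mul, twistedInversion_twistedInversion, map_inv, twistedInversion_inl, gfpInv_bPowGfp_eq,
    map_inv bPowGfp, map_inv] at h2
  rw [h2]
  group

/-- `D_u ≤ Π^tp_X̲̲` for EVERY `l` (twisted sections live on the `b`-axis): at the model «`D_τ ∩ Π^tp_X̲̲ = D_τ`».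
[cite: MochizukiEtTh2009, Def 2.7 p.41] -/
theorem map_sectionOfUnitχ_le_Huuχ (l : ℕ+) (u : (↥(ThetaSetting.modelχ p).Kdd)ˣ) :
    (ThetaSetting.modelχ p).GKdd.map (sectionOfUnitχ p u) ≤ Huuχ p l := by
  rintro _ ⟨σ, -, rfl⟩
  rw [mem_Huuχ_iff, sectionOfUnitχ_def, sectionχ_left, levelHom_bPowGfp]
  exact ⟨rfl, rfl⟩

/-- **(D), subgroup form**: `γ_g(ι(D_u)) = D_{u⁻¹}` and `γ_g(ι(D_{u⁻¹})) = D_u` for ONE `g ∈ Π^tp_X̲̲ ∩ Π^tp_Ÿ`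
(`D_u := sectionOfUnitχ u (G_K̈)`). [cite: MochizukiEtTh2009, Def 1.9 p.29] -/
theorem map_conj_map_twistedInversion_sectionOfUnitχ (u : (↥(ThetaSetting.modelχ p).Kdd)ˣ) :
    ∃ g : PiTpχ p, (∀ l : ℕ+, g ∈ Huuχ p l) ∧ g ∈ (ThetaSetting.modelχ p).GtpYdd ∧
      (((ThetaSetting.modelχ p).GKdd.map (sectionOfUnitχ p u)).map (twistedInversion (chi p)).toMonoidHom).map
          (MulAut.conj g).toMonoidHom = (ThetaSetting.modelχ p).GKdd.map (sectionOfUnitχ p u⁻¹) ∧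
      (((ThetaSetting.modelχ p).GKdd.map (sectionOfUnitχ p u⁻¹)).map (twistedInversion (chi p)).toMonoidHom).map
          (MulAut.conj g).toMonoidHom = (ThetaSetting.modelχ p).GKdd.map (sectionOfUnitχ p u) := by
  obtain ⟨g, -, hH, hY, -, -, hσ⟩ := exists_conj_twistedInversion_sectionOfUnitχ p u
  refine ⟨g, hH, hY, ?_, ?_⟩ <;>
  · rw [Subgroup.map_map, Subgroup.map_map]
    congr 1
    refine MonoidHom.ext fun σ => ?_
    rw [MonoidHom.comp_apply, MonoidHom.comp_apply, MulEquiv.coe_toMonoidHom, MulEquiv.coe_toMonoidHom, MulAut.conj_apply]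
    first | exact (hσ σ).1.symm | exact (hσ σ).2.symm

/-- **(D) for ANCHORED POINTS of Def. 1.9 shape**: the decomposition groups `D_y = sectionOfUnitχ u (G_K̈)` of the anchored
points with coordinates `u`, `u⁻¹` satisfy `γ_g(ι(D_{y})) = D_{y'}`, `γ_g(ι(D_{y'})) = D_y` for ONE `g ∈ Π^tp_X̲̲ ∩ Π^tp_Ÿ`.
[cite: MochizukiEtTh2009, Prop 1.4 (iii) p.22] -/
theorem map_conj_map_twistedInversion_Dpt_anchoredPointχ (u : (↥(ThetaSetting.modelχ p).Kdd)ˣ)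
    (hu : ∀ a : ℤ, ((u : (ThetaSetting.modelχ p).Kdd) : PadicAlgCl p) ≠ (ThetaSetting.modelχ p).qdd ^ a ∧
      ((u : (ThetaSetting.modelχ p).Kdd) : PadicAlgCl p) ≠ -((ThetaSetting.modelχ p).qdd ^ a))
    (hu' : ∀ a : ℤ, (((u⁻¹ : (↥(ThetaSetting.modelχ p).Kdd)ˣ) : (ThetaSetting.modelχ p).Kdd) : PadicAlgCl p) ≠
        (ThetaSetting.modelχ p).qdd ^ a ∧
      (((u⁻¹ : (↥(ThetaSetting.modelχ p).Kdd)ˣ) : (ThetaSetting.modelχ p).Kdd) : PadicAlgCl p) ≠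
        -((ThetaSetting.modelχ p).qdd ^ a)) :
    ∃ g : PiTpχ p, (∀ l : ℕ+, g ∈ Huuχ p l) ∧ g ∈ (ThetaSetting.modelχ p).GtpYdd ∧
      (((anchoredPointχ p u hu).Dpt).map (twistedInversion (chi p)).toMonoidHom).map (MulAut.conj g).toMonoidHom =
          (anchoredPointχ p u⁻¹ hu').Dpt ∧
      (((anchoredPointχ p u⁻¹ hu').Dpt).map (twistedInversion (chi p)).toMonoidHom).map (MulAut.conj g).toMonoidHom =
          (anchoredPointχ p u hu).Dpt := by
  rw [Dpt_anchoredPointχ, Dpt_anchoredPointχ]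
  exact map_conj_map_twistedInversion_sectionOfUnitχ p u

/-! ### §4. (E) The `Π^tp_C` form at `MuTwoSetting.inversionModelχ`: conjugation by `inclX g · ε_±` SWAPS `D_u`, `D_{u⁻¹}` -/

/-- Conjugation by `inclX g · ε_±` on `inclX(Π^tp_X)` is `inclX ∘ γ_g ∘ ι`. [cite: MochizukiEtTh2009, §2 p.36] -/
theorem conj_inclX_mul_epsPM_inclX (g x : PiTpχ p) :
    (MuTwoSetting.inversionModelχ p).inclX g * (MuTwoSetting.inversionModelχ p).epsPM *
        (MuTwoSetting.inversionModelχ p).inclX x *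
        ((MuTwoSetting.inversionModelχ p).inclX g * (MuTwoSetting.inversionModelχ p).epsPM)⁻¹ =
      (MuTwoSetting.inversionModelχ p).inclX (g * twistedInversion (chi p) x * g⁻¹) := by
  rw [map_mul, map_mul, map_inv, ← epsPM_conj_inlχ p x, MuTwoSetting.inversionModelχ_inclX,
    MuTwoSetting.inversionModelχ_inclX, MuTwoSetting.inversionModelχ_epsPM]
  group

/-- **(E) at `MuTwoSetting.inversionModelχ`** (`Π^tp_C = Π^tp_X ⋊_ι ℤ/2`, `ε_±`-conjugation = `ι` on `Π^tp_X`): for every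
unit `u` there is ONE `g ∈ Π^tp_X̲̲ ∩ Π^tp_Ÿ` such that conjugation by `inclX g · ε_±` carries `inclX(s_u σ) ↦ inclX(s_{u⁻¹} σ)`
AND `inclX(s_{u⁻¹} σ) ↦ inclX(s_u σ)` for all `σ` — the binder shape «`∃ u ∈ Π^tp_X̲̲, ∀ Dt ∈ {D_τ, D_{τ⁻¹}},
Dt.map (conj ε_± ≫ γ_u) ∈ {D_τ, D_{τ⁻¹}}`» decided POSITIVELY at the model. [cite: MochizukiEtTh2009, Rmk 1.9.1 p.29] -/
theorem exists_conj_inclX_mul_epsPM_sectionOfUnitχ (u : (↥(ThetaSetting.modelχ p).Kdd)ˣ) :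
    ∃ g : PiTpχ p, (∀ l : ℕ+, g ∈ Huuχ p l) ∧ g ∈ (ThetaSetting.modelχ p).GtpYdd ∧
      ∀ σ : GQp p,
        (MuTwoSetting.inversionModelχ p).inclX g * (MuTwoSetting.inversionModelχ p).epsPM *
            (MuTwoSetting.inversionModelχ p).inclX (sectionOfUnitχ p u σ) *
            ((MuTwoSetting.inversionModelχ p).inclX g * (MuTwoSetting.inversionModelχ p).epsPM)⁻¹ =
          (MuTwoSetting.inversionModelχ p).inclX (sectionOfUnitχ p u⁻¹ σ) ∧
        (MuTwoSetting.inversionModelχ p).inclX g * (MuTwoSetting.inversionModelχ p).epsPM *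
            (MuTwoSetting.inversionModelχ p).inclX (sectionOfUnitχ p u⁻¹ σ) *
            ((MuTwoSetting.inversionModelχ p).inclX g * (MuTwoSetting.inversionModelχ p).epsPM)⁻¹ =
          (MuTwoSetting.inversionModelχ p).inclX (sectionOfUnitχ p u σ) := by
  obtain ⟨g, -, hH, hY, -, -, hσ⟩ := exists_conj_twistedInversion_sectionOfUnitχ p u
  refine ⟨g, hH, hY, fun σ => ⟨?_, ?_⟩⟩
  · rw [conj_inclX_mul_epsPM_inclX, ← (hσ σ).1]
  · rw [conj_inclX_mul_epsPM_inclX, ← (hσ σ).2]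

/-- **(E), subgroup form**: `(inclX D_u)^{inclX g · ε_±} = inclX D_{u⁻¹}` and `(inclX D_{u⁻¹})^{inclX g · ε_±} = inclX D_u`.
[cite: MochizukiEtTh2009, Rmk 1.9.1 p.29] -/
theorem exists_map_conj_inclX_mul_epsPM_sectionOfUnitχ (u : (↥(ThetaSetting.modelχ p).Kdd)ˣ) :
    ∃ g : PiTpχ p, (∀ l : ℕ+, g ∈ Huuχ p l) ∧ g ∈ (ThetaSetting.modelχ p).GtpYdd ∧
      ((((ThetaSetting.modelχ p).GKdd.map (sectionOfUnitχ p u)).map (MuTwoSetting.inversionModelχ p).inclX).map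
          (MulAut.conj ((MuTwoSetting.inversionModelχ p).inclX g * (MuTwoSetting.inversionModelχ p).epsPM)).toMonoidHom =
        ((ThetaSetting.modelχ p).GKdd.map (sectionOfUnitχ p u⁻¹)).map (MuTwoSetting.inversionModelχ p).inclX) ∧
      ((((ThetaSetting.modelχ p).GKdd.map (sectionOfUnitχ p u⁻¹)).map (MuTwoSetting.inversionModelχ p).inclX).map
          (MulAut.conj ((MuTwoSetting.inversionModelχ p).inclX g * (MuTwoSetting.inversionModelχ p).epsPM)).toMonoidHom =
        ((ThetaSetting.modelχ p).GKdd.map (sectionOfUnitχ p u)).map (MuTwoSetting.inversionModelχ p).inclX) := by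
  obtain ⟨g, hH, hY, hσ⟩ := exists_conj_inclX_mul_epsPM_sectionOfUnitχ p u
  refine ⟨g, hH, hY, ?_, ?_⟩ <;>
  · rw [Subgroup.map_map, Subgroup.map_map, Subgroup.map_map]
    congr 1
    refine MonoidHom.ext fun σ => ?_
    rw [MonoidHom.comp_apply, MonoidHom.comp_apply, MonoidHom.comp_apply, MulEquiv.coe_toMonoidHom, MulAut.conj_apply]
    first | exact (hσ σ).1 | exact (hσ σ).2

/-! ### §5. (F) `p ≡ 1 (mod 4)`: the Def. 1.9 points `τ := anchoredPointχ √−1`, `τ⁻¹ := anchoredPointχ (√−1)⁻¹` -/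

/-- The unit `(√−1)⁻¹` of abc-iut-w5-d140 IS the inverse of the unit `√−1`. [cite: MochizukiEtTh2009, Def 1.9 p.29] -/
theorem sqrtNegOneInvUnitχ_eq_inv (hp : p % 4 = 1) : sqrtNegOneInvUnitχ p hp = (sqrtNegOneUnitχ p hp)⁻¹ := by
  rw [eq_inv_iff_mul_eq_one]
  apply Units.ext
  apply Subtype.ext
  rw [Units.val_mul, Units.val_one, MulMemClass.coe_mul, OneMemClass.coe_one, coe_sqrtNegOneInvUnitχ, coe_sqrtNegOneUnitχ,
    inv_mul_cancel₀ (sqrtNegOneχ_ne_zero p hp)]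

/-- **abc-iut-w5-d140's r5 lemma `exists_invχ_sectionOfUnitχ_conj` UPGRADED** (consumed BY NAME): its conjugator
`g = inl(b^{c₀·c₀})` lies in `Π^tp_X̲̲` (every `l`) and in `Π^tp_Ÿ` (not only in `Π^tp_Ẍ`), and the SAME `g` serves the other
direction: `ι(s_τ σ) = g·s_{τ⁻¹}(σ)·g⁻¹` AND `ι(s_{τ⁻¹} σ) = g·s_τ(σ)·g⁻¹` (apply `ι`: `ι g = g⁻¹`).
[cite: MochizukiEtTh2009, Rmk 1.9.1 p.29] -/
theorem exists_invχ_sectionOfUnitχ_conj_symm (hp : p % 4 = 1) :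
    ∃ g : PiTpχ p, (∀ l : ℕ+, g ∈ Huuχ p l) ∧ g ∈ (ThetaSetting.modelχ p).GtpYdd ∧
      ∀ σ : GQp p,
        invχ p (sectionOfUnitχ p (sqrtNegOneUnitχ p hp) σ) = g * sectionOfUnitχ p (sqrtNegOneInvUnitχ p hp) σ * g⁻¹ ∧
        invχ p (sectionOfUnitχ p (sqrtNegOneInvUnitχ p hp) σ) = g * sectionOfUnitχ p (sqrtNegOneUnitχ p hp) σ * g⁻¹ := by
  obtain ⟨c₀, hc₀⟩ := exists_invχ_sectionOfUnitχ_conj p hp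
  refine ⟨SemidirectProduct.inl (bPowGfp (c₀ * c₀)), fun l => inl_bPowGfp_mem_Huuχ p l _,
    inl_bPowGfp_mul_self_mem_GtpYdd p c₀, fun σ => ⟨hc₀ σ, ?_⟩⟩
  have h := congrArg (invχ p) (hc₀ σ)
  simp only [invχ, twistedInversionTop_apply, map_mul, map_inv, twistedInversion_twistedInversion, twistedInversion_inl,
    gfpInv_bPowGfp_eq] at h ⊢
  rw [h]
  group

/-- **(F) `ι(D_τ)` and `D_{τ⁻¹}` at `modelχ`, `p ≡ 1 (mod 4)`**: ONE `g ∈ Π^tp_X̲̲ ∩ Π^tp_Ÿ` with `γ_g(ι(D_τ)) = D_{τ⁻¹}` and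
`γ_g(ι(D_{τ⁻¹})) = D_τ` (`τ^{±1} := tauχ / tauInvχ` of abc-iut-w5-d140). [cite: MochizukiEtTh2009, Def 1.9 p.29] -/
theorem exists_conj_twistedInversion_tauχ (hp : p % 4 = 1) :
    ∃ g : PiTpχ p, (∀ l : ℕ+, g ∈ Huuχ p l) ∧ g ∈ (ThetaSetting.modelχ p).GtpYdd ∧
      (((tauχ p hp).Dpt).map (twistedInversion (chi p)).toMonoidHom).map (MulAut.conj g).toMonoidHom =
          (tauInvχ p hp).Dpt ∧
      (((tauInvχ p hp).Dpt).map (twistedInversion (chi p)).toMonoidHom).map (MulAut.conj g).toMonoidHom =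
          (tauχ p hp).Dpt := by
  rw [Dpt_anchoredPointχ, Dpt_anchoredPointχ, sqrtNegOneInvUnitχ_eq_inv]
  exact map_conj_map_twistedInversion_sectionOfUnitχ p (sqrtNegOneUnitχ p hp)

/-- **(F), `Π^tp_C` form at `inversionModelχ`**: conjugation by `inclX g · ε_±` SWAPS `inclX(D_τ)` and `inclX(D_{τ⁻¹})` —
Rmk. 1.9.1's «`ε_±` maps `τ` to `τ⁻¹`» holds at the model UP TO the inner `γ_g`, `g ∈ Π^tp_X̲̲ ∩ Π^tp_Ÿ`.
[cite: MochizukiEtTh2009, Rmk 1.9.1 p.29] -/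
theorem exists_conj_inclX_mul_epsPM_tauχ (hp : p % 4 = 1) :
    ∃ g : PiTpχ p, (∀ l : ℕ+, g ∈ Huuχ p l) ∧ g ∈ (ThetaSetting.modelχ p).GtpYdd ∧
      ((((tauχ p hp).Dpt).map (MuTwoSetting.inversionModelχ p).inclX).map
          (MulAut.conj ((MuTwoSetting.inversionModelχ p).inclX g * (MuTwoSetting.inversionModelχ p).epsPM)).toMonoidHom =
        ((tauInvχ p hp).Dpt).map (MuTwoSetting.inversionModelχ p).inclX) ∧
      ((((tauInvχ p hp).Dpt).map (MuTwoSetting.inversionModelχ p).inclX).map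
          (MulAut.conj ((MuTwoSetting.inversionModelχ p).inclX g * (MuTwoSetting.inversionModelχ p).epsPM)).toMonoidHom =
        ((tauχ p hp).Dpt).map (MuTwoSetting.inversionModelχ p).inclX) := by
  rw [Dpt_anchoredPointχ, Dpt_anchoredPointχ, sqrtNegOneInvUnitχ_eq_inv]
  exact exists_map_conj_inclX_mul_epsPM_sectionOfUnitχ p (sqrtNegOneUnitχ p hp)

/-! ### §6. (G) The same for every `b`-twisted lift `Ad(inl b^m) ∘ ι` of the inversion -/

/-- **(G)** For every `m ∈ Ẑ`, the lift `Γ_m := Ad(inl b^m) ∘ ι` (for odd `m` the lifts of abc-iut-w5-d125's design memo,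
fixing `inr σ` only up to a `χ`-coboundary) ALSO carries `s_u` to a conjugate of `s_{u⁻¹}` and back with ONE conjugator
`g' = g · inl(b^m)⁻¹ ∈ Π^tp_X̲̲` (a `b`-power; in `Π^tp_Ÿ` iff `m` is even). [cite: MochizukiEtTh2009, §2 p.36] -/
theorem exists_conj_innerTwistedInversion_sectionOfUnitχ (u : (↥(ThetaSetting.modelχ p).Kdd)ˣ) (m : ZH) :
    ∃ g' : PiTpχ p, (∃ w : ZH, g' = SemidirectProduct.inl (bPowGfp w)) ∧ (∀ l : ℕ+, g' ∈ Huuχ p l) ∧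
      ∀ σ : GQp p,
        sectionOfUnitχ p u⁻¹ σ = g' * (SemidirectProduct.inl (bPowGfp m) *
          twistedInversion (chi p) (sectionOfUnitχ p u σ) * (SemidirectProduct.inl (bPowGfp m))⁻¹) * g'⁻¹ ∧
        sectionOfUnitχ p u σ = g' * (SemidirectProduct.inl (bPowGfp m) *
          twistedInversion (chi p) (sectionOfUnitχ p u⁻¹ σ) * (SemidirectProduct.inl (bPowGfp m))⁻¹) * g'⁻¹ := by
  obtain ⟨g, ⟨w, rfl⟩, -, -, -, -, hσ⟩ := exists_conj_twistedInversion_sectionOfUnitχ p u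
  refine ⟨SemidirectProduct.inl (bPowGfp (w * w)) * (SemidirectProduct.inl (bPowGfp m))⁻¹, ⟨w * w / m, ?_⟩,
    fun l => ?_, fun σ => ⟨?_, ?_⟩⟩
  · rw [map_div, map_div, div_eq_mul_inv]
  · rw [← map_inv, ← map_inv, ← map_mul, ← map_mul]
    exact inl_bPowGfp_mem_Huuχ p l _
  · rw [(hσ σ).1]
    group
  · rw [(hσ σ).2]
    group

end Literature.AnabelianGeometry.EtaleTheta.SettingModel

end
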